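import Literature.IUT.HodgeArakelov.ThetaEvaluationModelEvRetraction
import Literature.IUT.HodgeArakelov.CohomologyLimitKummerMLF
import Mathlib.Topology.Algebra.Group.ClosedSubgroup

/-!
# The side conditions `hlift`, `hemb` of the canonical level retractions from COMPACTNESS of the decomposition
# group and finite index of its image ([IUTchII] Cor. 1.12 (c)/(ii); [SemiAnbd] §6 "`D_x` is compact and surjects onto
# an open subgroup of `G_K`") — proof companion

Proof-only companion (abc-iut cell, D-0067 wave 4, seat abc-iut-w4-d043 gen 2; L6-lead ruling §F v1.18c (1); SUBDAG
`plan/L6/SUBDAG-IUTchII-Cor-112.md` rows Cor-112.0.r1 / Cor-112.ii.r13) to `ThetaEvaluationModelEvRetraction.lean` (p418359: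
`liftSubgroup`, `retract`, `LevelRetraction.ofAugmentation` with the `Prop` binders `hlift` — the lifted levels
`K ∩ q⁻¹(q(D ∩ K))` are finite-index open — and `hemb` — `q|_{D ∩ K}` is a topological embedding). No definitions.

S. Mochizuki, *Semi-graphs of anabelioids*, Publ. RIMS **42** (2006), §6 p. 71 [cite: MochizukiSemiAnbd2006, §6 p.71]
("`D_x` always surjects onto an open subgroup of `G_K`"; compactness of `D_x`: the cell's
`TemperedCurve.isCompact_decomp_of_isTempered`, `TemperedDecompositionCompact.lean`); [IUTchII] Rmk. 1.4.1 (ii) p. 28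
(`D_{μ_-}` is the decomposition group of the point `(μ_-)_Ÿ`). Claim key of the consumer `Mochizuki2012` (DISPUTED);
elementary topological group theory; nothing here takes a side on [IUTchIII] Cor. 3.12.

PROVED, for a continuous homomorphism `q : Π → Q` to a Hausdorff topological group, a COMPACT subgroup `D ≤ Π` on
which `q` is injective, with `q(D)` of finite index in `Q`:
* (abc-iut-w4-d007's `finiteIndex_map_inf`, `CohomologyLimitKummerMLF`, reused BY NAME) `q(D ∩ K)` has finite index
  for `K` of finite index;
* (private) `finiteIndex_comap_of_finiteIndex` — `q⁻¹(M)` has finite index for `M` of finite index;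
* `isOpen_map_inf` — `q(D ∩ K)` is OPEN for `K` finite-index open (compact image ⇒ closed; closed of finite index
  ⇒ open);
* **`hlift_of_isCompact`** — the binder `hlift` of `LevelRetraction.ofAugmentation`;
* **`hemb_of_isCompact`** — the binder `hemb`: `q|_{D ∩ K}` is a topological embedding for EVERY `K` (a continuous
  injection from a compact space to a Hausdorff space is a closed embedding; restrict to `D ∩ K`).
So the retraction side conditions reduce to the NAMED facts "`D_{μ_-}` compact", "`ε(D_{μ_-})` of finite index in
`G_{ℚ_p}`" and "`D_{μ_-} ∩ Δ = 1`". Typed ≠ discharged for those.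
-/

noncomputable section

namespace Literature.IUT.HodgeArakelov

open CohomologySystemOfContH1

namespace CohomologySystemOfContH1

universe u

variable {P : TopGroup.{u}} {Q : Type u} [Group Q] (q : P →* Q) (D : Subgroup P)

/-- The preimage of a finite-index subgroup has finite index. [folklore] -/
private theorem finiteIndex_comap_of_finiteIndex (M : Subgroup Q) [M.FiniteIndex] : (M.comap q).FiniteIndex := by
  refine ⟨fun h0 => ?_⟩
  rw [Subgroup.index_comap] at h0
  exact (inferInstance : (M.subgroupOf q.range).FiniteIndex).index_ne_zero h0

variable [TopologicalSpace Q] [IsTopologicalGroup Q] [T2Space Q]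

/-- `D ∩ K` is compact for `D` compact and `K` an open (hence closed) subgroup. [folklore] -/
private theorem isCompact_inf_of_isOpen (hDc : IsCompact (D : Set P)) (K : Subgroup P) (hK : IsOpen (K : Set P)) :
    IsCompact ((D ⊓ K : Subgroup P) : Set P) := by
  rw [Subgroup.coe_inf]
  exact hDc.inter_right (K.isClosed_of_isOpen hK)

/-- `q(D ∩ K)` is OPEN in `Q` for `K` finite-index open: it is closed (continuous image of a compact set in a Hausdorff
group) and of finite index ("`D_x` surjects onto an open subgroup of `G_K`"). [cite: MochizukiSemiAnbd2006, §6 p.71] -/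
theorem isOpen_map_inf (hq : Continuous q) (hDc : IsCompact (D : Set P)) [(D.map q).FiniteIndex] (K : Subgroup P)
    [K.FiniteIndex] (hK : IsOpen (K : Set P)) : IsOpen (((D ⊓ K).map q : Subgroup Q) : Set Q) := by
  haveI := finiteIndex_map_inf q D K
  refine Subgroup.isOpen_of_isClosed_of_finiteIndex _ ?_
  rw [Subgroup.coe_map]
  exact ((isCompact_inf_of_isOpen D hDc K hK).image hq).isClosed

/-- **The binder `hlift` of `LevelRetraction.ofAugmentation` from compactness**: for `q` continuous, `D` compact with
`q(D)` of finite index, every lifted level `K ∩ q⁻¹(q(D ∩ K))` of a finite-index open `K` is finite-index open.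
[cite: Mochizuki2012, Cor 1.12 (c) p.56] -/
theorem hlift_of_isCompact (hq : Continuous q) (hDc : IsCompact (D : Set P)) [(D.map q).FiniteIndex] :
    ∀ K : Subgroup P, K.FiniteIndex → IsOpen (K : Set P) →
      (liftSubgroup q D K).FiniteIndex ∧ IsOpen (liftSubgroup q D K : Set P) := by
  intro K hK hKo
  haveI := hK
  haveI := finiteIndex_map_inf q D K
  haveI := finiteIndex_comap_of_finiteIndex q (((D ⊓ K).map q))
  refine ⟨by unfold liftSubgroup; infer_instance, ?_⟩
  change IsOpen ((K ⊓ ((D ⊓ K).map q).comap q : Subgroup P) : Set P)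
  rw [Subgroup.coe_inf, Subgroup.coe_comap]
  exact hKo.inter ((isOpen_map_inf q D hq hDc K hKo).preimage hq)

omit [IsTopologicalGroup Q] in
/-- **The binder `hemb` of `LevelRetraction.ofAugmentation` from compactness**: for `q` continuous, `D` compact and
`q` injective on `D` ("`D_{μ_-} ∩ Δ = 1`"), `q|_{D ∩ K}` is a topological embedding for every `K` (a continuous injection
from a compact space into a Hausdorff space is a closed embedding). [cite: Mochizuki2012, Cor 1.12 (c) p.56] -/
theorem hemb_of_isCompact (hq : Continuous q) (hDc : IsCompact (D : Set P)) (hDq : ∀ d ∈ D, q d = 1 → d = 1) :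
    ∀ K : Subgroup P, Topology.IsEmbedding fun d : ↥(D ⊓ K) => q (d : P) := by
  intro K
  haveI : CompactSpace D := isCompact_iff_compactSpace.mp hDc
  -- `q|_D` is a closed embedding
  have hinj : Function.Injective fun d : D => q (d : P) := by
    intro a b hab
    apply Subtype.ext
    have h1 : q ((a : P) * (b : P)⁻¹) = 1 := by
      change q (a : P) = q (b : P) at hab
      rw [map_mul, map_inv, hab, mul_inv_cancel]
    exact mul_inv_eq_one.mp (hDq _ (D.mul_mem a.2 (D.inv_mem b.2)) h1)
  have hemb : Topology.IsEmbedding fun d : D => q (d : P) :=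
    ((hq.comp continuous_subtype_val).isClosedEmbedding hinj).isEmbedding
  -- restrict along the inclusion `D ⊓ K ↪ D`
  have hincl : Topology.IsEmbedding (Subgroup.inclusion (inf_le_left : D ⊓ K ≤ D)) :=
    (Topology.IsEmbedding.subtypeVal.of_comp_iff).mp Topology.IsEmbedding.subtypeVal
  exact hemb.comp hincl

/-- **The canonical level retractions from the NAMED facts**: for `q : Π → Q` continuous to a Hausdorff topological
group, `D ≤ H ≤ Π` with `D` COMPACT, `D ∩ Ker(q) = 1`, `q(D)` of finite index in `Q`, and `Ker(q)` acting trivially on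
the coefficients — `LevelRetraction.ofAugmentation` with `hlift`, `hemb` DISCHARGED. The section identity, specialised.
[cite: Mochizuki2012, Cor 1.12 (ii) p.57] -/
theorem h1LimRestrict_h1LimSection_ofAugmentation_of_isCompact {G' : Type u} [Group G'] [TopologicalSpace G']
    [IsTopologicalGroup G'] (φ : P →* G') (A : Subgroup G') [A.Normal] [IsMulCommutative A]
    (hDq : ∀ d ∈ D, q d = 1 → d = 1) (H : Subgroup P) (hq : Continuous q)
    (hN : ∀ n : P, q n = 1 → ∀ a : A, MulAut.conjNormal (φ n) a = a)
    (hDc : IsCompact (D : Set P)) [(D.map q).FiniteIndex] (hDH : D ≤ H) (x : h1Lim φ A D ⊥) :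
    h1LimRestrict φ A hDH ⊥
      ((LevelRetraction.ofAugmentation φ A q D hDq H hq hN (hlift_of_isCompact q D hq hDc)
        (hemb_of_isCompact q D hq hDc hDq)).h1LimSection x) = x :=
  h1LimRestrict_h1LimSection_ofAugmentation φ A q D hDq H hq hN _ _ hDH x

end CohomologySystemOfContH1

end Literature.IUT.HodgeArakelov
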